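import Mathlib
import Summits.Schanuel.Schanuel.Theorems.RoyCriterionSchanuelTwoStubNesterenkoPlanes
import Summits.Schanuel.Schanuel.Theorems.RigidCoreSchanuelOnLogFreeCoreRelLWZeroOffAxes
import Summits.Schanuel.Schanuel.Theorems.RigidCoreSchanuelOnLogFreeCoreExceptionalLineDichotomy
import Summits.Schanuel.Schanuel.Theorems.RigidCoreSchanuelOnLogFreeCoreCalibrationR

/-!
# Line `sector-split` (v13 "conjugate norms") of crux `RigidCore.SchanuelOnLogFreeCore`: `π ⊥ e^u` for `Re u ∈ ℚ*π ∪ ℚ*π√3`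

Crux `stmt-Schanuel-0970` (`Summit.Schanuel.Schanuel.Theses.RigidCore.SchanuelOnLogFreeCore`, (R):
Schanuel's conjecture for `ℚ`-free tuples from the log-free core `C_EA`), line `sector-split`,
skeleton v13 (lead c6).  This file proves the two π-ANCHORED calibration stubs of v13:

* `stub_algebraicIndependent_pi_exp_of_re` (C2) — **`π` and `e^u` are algebraically independent for
  every complex number `u` whose real part is a nonzero rational multiple of `π` or of `π√3`**
  (e.g. `π ⊥ e^{π+i}`, `π ⊥ e^{π/2+i√2}`, `π ⊥ e^{π√3−7i}`; the imaginary part is arbitrary);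
* `stub_cruxCell_piI_of_re` (C3) — the corresponding rank-2 cell of (R), indeed of Schanuel's
  conjecture with no core and no independence hypothesis: for `x = (πi, u)` with such a `u`,
  `trdeg_ℚ ℚ(x, e^x) ≥ 2`.

Device ("conjugate norms", idea card `conjugate-product-sectors`): `ℚ(π)` is fixed pointwise by
complex conjugation, so if `e^u` were algebraic over `ℚ(π)` then so would be `conj (e^u) = e^{ū}`
(tree lemma `RelLWZeroOffAxes.isAlgebraic_adjoin_pi_conj`) and hence the conjugate norm
`e^u · e^{ū} = e^{2 Re u} = e^{2qc}` (`c = π` or `π√3`).  Writing `q = m/n`, `(e^{2qc})^n = (e^c)^{2m}`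
with `2m ≠ 0`, so `e^c` would be algebraic over `ℚ(π)` — contradicting Nesterenko's theorem
(`π ⊥ e^π`: tree `algebraicIndependent_pi_exp_pi` over `nesterenko_holds`; `π ⊥ e^{π√3}`: tree
`algebraicIndependent_pi_exp_pi_mul_sqrt_three` over `nesterenko'_holds`; both PROVED in the tree).
The rank-2 cell then follows from the plane bookkeeping of the sibling crux `SchanuelTwo`
(`two_le_trdeg_SF_of_isAlgebraic_pair`: two algebraically independent numbers algebraic over
`K_x = ℚ(x, e^x)` force `trdeg K_x ≥ 2`; here `π`, a root of `X² + (πi)²`, and `e^u ∈ K_x`).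

Placement.  The disprover's `rank_two_through_pi` settles the pairs through `π`; c2's
`KernelTower.algebraicIndependent_pi_exp_offAxes` settles `(πi, α)` for algebraic `α` off the axes;
this file settles `(πi, u)` for `Re u ∈ ℚ*π ∪ ℚ*π√3`.  NOT here: the pairs `(πi, α)` with `α`
algebraic ON an axis (`e ⊥ π`, `π ⊥ e^{i}`) — residue 1′ of the line, open; nothing about residue 2.

## References

* [NesterenkoPhilippon2001] Yu. V. Nesterenko, P. Philippon (eds.), *Introduction to Algebraic
  Independence Theory*, LNM 1752 (2001): Ch. 3 §1 Corollary 1.2 (`π, e^π, Γ(1/4)`); Ch. 1 §3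
  Corollary 3.2 (`π, e^{π√3}, Γ(1/3)`).
-/

noncomputable section

-- `Summit.Schanuel.Schanuel.…` is the D-0017 single-problem layout
set_option linter.dupNamespace false

namespace Summit.Schanuel.Schanuel.Theorems.RigidCore

open IntermediateField
open Literature.NumberTheory.Transcendental
open Literature.NumberTheory.Transcendental.Specialization

namespace PiExpOfRe

/-! ## Helpers -/

/-- The anchors: for `c = π` or `c = π√3`, `π` and `e^{c}` are algebraically independent over `ℚ`
(Nesterenko 1996 at `τ = i` and `τ = ρ`, tree theorems `algebraicIndependent_pi_exp_pi`,
`algebraicIndependent_pi_exp_pi_mul_sqrt_three`).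
[cite: NesterenkoPhilippon2001, Ch. 3 Cor. 1.2 and Ch. 1 §3 Cor. 3.2] -/
theorem exists_anchor {q : ℚ} {u : ℂ}
    (hre : u.re = q * Real.pi ∨ u.re = q * (Real.pi * Real.sqrt 3)) :
    ∃ c : ℝ, u.re = q * c ∧ AlgebraicIndependent ℚ ![(Real.pi : ℂ), Complex.exp (c : ℂ)] := by
  rcases hre with h | h
  · refine ⟨Real.pi, h, ?_⟩
    have e : Complex.exp ((Real.pi : ℝ) : ℂ) = ((Real.exp Real.pi : ℝ) : ℂ) := by
      rw [Complex.ofReal_exp]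
    rw [e]
    exact algebraicIndependent_pi_exp_pi
  · refine ⟨Real.pi * Real.sqrt 3, h, ?_⟩
    have e : Complex.exp ((Real.pi * Real.sqrt 3 : ℝ) : ℂ) =
        ((Real.exp (Real.pi * Real.sqrt 3) : ℝ) : ℂ) := by
      rw [Complex.ofReal_exp]
    rw [e]
    exact algebraicIndependent_pi_exp_pi_mul_sqrt_three

/-- The conjugate norm of an exponential: `e^u · e^{ū} = e^{2 Re u}`. [folklore] -/
theorem exp_mul_exp_conj (u : ℂ) :
    Complex.exp u * Complex.exp ((starRingEnd ℂ) u) = Complex.exp (2 * (u.re : ℂ)) := by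
  rw [← Complex.exp_add, Complex.add_conj]
  push_cast
  ring_nf

/-- Rational bookkeeping: if `r = q · c` with `q = m/n ≠ 0` then `(e^{2r})^n = (e^{c})^{2m}`
(as an integer power). [folklore] -/
theorem exp_two_mul_pow_den {q : ℚ} {r c : ℝ} (h : r = q * c) :
    Complex.exp (2 * (r : ℂ)) ^ q.den = Complex.exp (c : ℂ) ^ (2 * q.num) := by
  rw [← Complex.exp_nat_mul, ← Complex.exp_int_mul]
  congr 1
  have hq : (q : ℝ) * q.den = q.num := by exact_mod_cast Rat.mul_den_eq_num q
  have hq' : (q : ℂ) * (q.den : ℂ) = (q.num : ℂ) := by exact_mod_cast hq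
  rw [h]
  push_cast
  linear_combination (2 * (c : ℂ)) * hq'

/-- If `z ^ k` is algebraic over a field `F ≤ ℂ` for a nonzero integer `k`, then so is `z`
(`IsAlgebraic.of_pow` for `k > 0`; invert first for `k < 0`). [folklore] -/
theorem isAlgebraic_of_zpow {F : IntermediateField ℚ ℂ} {z : ℂ} {k : ℤ} (hk : k ≠ 0)
    (h : IsAlgebraic F (z ^ k)) : IsAlgebraic F z := by
  rcases lt_or_gt_of_ne hk with hlt | hgt
  · have hk' : 0 < (-k).toNat := by omega
    have e : z ^ k = (z ^ (-k).toNat)⁻¹ := by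
      rw [← zpow_natCast, Int.toNat_of_nonneg (by omega), zpow_neg, inv_inv]
    rw [e, IsAlgebraic.inv_iff] at h
    exact h.of_pow hk'
  · have hk' : 0 < k.toNat := by omega
    have e : z ^ k = z ^ k.toNat := by
      rw [← zpow_natCast, Int.toNat_of_nonneg hgt.le]
    rw [e] at h
    exact h.of_pow hk'

end PiExpOfRe

open PiExpOfRe RelLWZeroOffAxes LineDichotomy CalibrationR

/-! ## Stub C2: `π ⊥ e^u` for `Re u ∈ ℚ*·π ∪ ℚ*·π√3` -/

/-- **Stub `stub_algebraicIndependent_pi_exp_of_re` of line `sector-split` (v13, C2; registered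
signature).**  For every nonzero rational `q` and every `u : ℂ` with `Re u = qπ` or `Re u = qπ√3`,
`π` and `e^u` are algebraically independent over `ℚ`.  Proof: if not, `e^u` is algebraic over
`ℚ(π)` (`π` being transcendental), hence so is `e^{ū} = conj(e^u)` (`ℚ(π)` is conj-fixed) and the
conjugate norm `e^{2 Re u}`; then `(e^{2 Re u})^{den q} = (e^{c})^{2 num q}` makes `e^{c}`
(`c = π`, resp. `π√3`) algebraic over `ℚ(π)`, contradicting Nesterenko.
[cite: NesterenkoPhilippon2001, Ch. 3 Cor. 1.2 and Ch. 1 §3 Cor. 3.2] -/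
theorem stub_algebraicIndependent_pi_exp_of_re :
    ∀ (q : ℚ) (u : ℂ), q ≠ 0 →
      (u.re = q * Real.pi ∨ u.re = q * (Real.pi * Real.sqrt 3)) →
      AlgebraicIndependent ℚ ![(Real.pi : ℂ), Complex.exp u] := by
  intro q u hq hre
  obtain ⟨c, hc, hz⟩ := exists_anchor hre
  by_contra hnot
  set F : IntermediateField ℚ ℂ := adjoin ℚ ({(Real.pi : ℂ)} : Set ℂ) with hF
  -- `e^u` is algebraic over `ℚ(π)`
  have h1 : IsAlgebraic F (Complex.exp u) := by
    rw [hF, IntermediateField.isAlgebraic_adjoin_iff]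
    exact isAlgebraic_adjoin_of_not_algebraicIndependent transcendental_pi_complex hnot
  -- hence so is `e^{ū} = conj (e^u)` (conjugation fixes `ℚ(π)`)
  have h2 : IsAlgebraic F (Complex.exp ((starRingEnd ℂ) u)) := by
    rw [Complex.exp_conj]
    exact isAlgebraic_adjoin_pi_conj h1
  -- and the conjugate norm `e^{2 Re u}`
  have h3 : IsAlgebraic F (Complex.exp (2 * (u.re : ℂ))) := by
    rw [← exp_mul_exp_conj]
    exact h1.mul h2
  -- `(e^{2 Re u})^{den q} = (e^c)^{2 num q}`, so `e^c` is algebraic over `ℚ(π)`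
  have h4 : IsAlgebraic F (Complex.exp (c : ℂ)) := by
    have hpow : IsAlgebraic F (Complex.exp (c : ℂ) ^ (2 * q.num)) := by
      rw [← exp_two_mul_pow_den hc]
      exact h3.pow _
    exact isAlgebraic_of_zpow (mul_ne_zero two_ne_zero (Rat.num_ne_zero.2 hq)) hpow
  -- contradiction with Nesterenko: `e^c` is transcendental over `ℚ(π)`
  exact (transcendental_adjoin_of_algebraicIndependent_pair hz).1 h4

/-! ## Stub C3: the rank-2 cell `x = (πi, u)` of (R) / Schanuel -/

/-- **Stub `stub_cruxCell_piI_of_re` of line `sector-split` (v13, C3; registered signature).**  For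
`x : Fin 2 → ℂ` with `x 0 = πi` and `Re (x 1) ∈ ℚ*·π ∪ ℚ*·π√3`,
`2 ≤ trdeg_ℚ ℚ(x 0, x 1, e^{x 0}, e^{x 1})` — the conclusion of (R) (and of Schanuel) at `x`, with
no core and no linear-independence hypothesis: `π` is algebraic over `K_x` (a root of `X² + (x 0)²`),
`e^{x 1} ∈ K_x`, and `π ⊥ e^{x 1}` by stub C2; two algebraically independent numbers algebraic over
`K_x` give `trdeg K_x ≥ 2` (`two_le_trdeg_SF_of_isAlgebraic_pair`).
[cite: NesterenkoPhilippon2001, Ch. 3 Cor. 1.2 and Ch. 1 §3 Cor. 3.2] -/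
theorem stub_cruxCell_piI_of_re :
    ∀ (q : ℚ) (x : Fin 2 → ℂ), q ≠ 0 → x 0 = ↑Real.pi * Complex.I →
      ((x 1).re = q * Real.pi ∨ (x 1).re = q * (Real.pi * Real.sqrt 3)) →
      ((2 : ℕ) : Cardinal) ≤ Algebra.trdeg ℚ
        ↥(IntermediateField.adjoin ℚ (Set.range x ∪ Set.range (Complex.exp ∘ x))) := by
  intro q x hq h0 hre
  have hind := stub_algebraicIndependent_pi_exp_of_re q (x 1) hq hre
  set K : IntermediateField ℚ ℂ := adjoin ℚ (Set.range x ∪ Set.range (Complex.exp ∘ x)) with hK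
  -- `x 0 = πi ∈ K`, so `π` is a root of `X² + (x 0)²` over `K`
  have hx0 : x 0 ∈ K := subset_adjoin ℚ _ (Or.inl ⟨0, rfl⟩)
  have hπ : IsAlgebraic K (Real.pi : ℂ) := by
    refine ⟨Polynomial.X ^ 2 + Polynomial.C (⟨x 0, hx0⟩ ^ 2), ?_, ?_⟩
    · exact (Polynomial.monic_X_pow_add_C _ two_ne_zero).ne_zero
    · simp only [map_add, map_pow, Polynomial.aeval_X, Polynomial.aeval_C,
        IntermediateField.algebraMap_apply]
      rw [h0]
      ring_nf
      rw [Complex.I_sq]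
      ring
  -- `e^{x 1} ∈ K`
  have he : IsAlgebraic K (Complex.exp (x 1)) :=
    isAlgebraic_algebraMap (⟨Complex.exp (x 1), subset_adjoin ℚ _ (Or.inr ⟨1, rfl⟩)⟩ : K)
  have h := two_le_trdeg_SF_of_isAlgebraic_pair x hind hπ he
  exact_mod_cast h

/-! ## Cells -/

/-- Cell: `π ⊥ e^{π + i}`. [cite: NesterenkoPhilippon2001, Ch. 3 Cor. 1.2] -/
theorem PiExpOfRe.algebraicIndependent_pi_exp_pi_add_I :
    AlgebraicIndependent ℚ ![(Real.pi : ℂ), Complex.exp (↑Real.pi + Complex.I)] := by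
  have h : (↑Real.pi + Complex.I : ℂ).re = ((1 : ℚ) : ℝ) * Real.pi := by simp
  exact stub_algebraicIndependent_pi_exp_of_re 1 _ one_ne_zero (Or.inl h)

/-- Cell: `π ⊥ e^{π√3 + iy}` for every real `y`. [cite: NesterenkoPhilippon2001, Ch. 1 §3 Cor. 3.2] -/
theorem PiExpOfRe.algebraicIndependent_pi_exp_pi_sqrt_three_add (y : ℝ) :
    AlgebraicIndependent ℚ
      ![(Real.pi : ℂ), Complex.exp (↑(Real.pi * Real.sqrt 3) + ↑y * Complex.I)] := by
  have h : (↑(Real.pi * Real.sqrt 3) + ↑y * Complex.I : ℂ).re =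
      ((1 : ℚ) : ℝ) * (Real.pi * Real.sqrt 3) := by simp
  exact stub_algebraicIndependent_pi_exp_of_re 1 _ one_ne_zero (Or.inr h)

/-- Cell of (R): the core pair `(πi, π/2 + i)` — `trdeg ℚ(πi, π/2 + i, −1, i e^{π/2}) ≥ 2`, i.e.
`π ⊥ e^{π/2}` read through the conjugate norm. [cite: NesterenkoPhilippon2001, Ch. 3 Cor. 1.2] -/
theorem PiExpOfRe.cruxCell_piI_half_pi_add_I :
    ((2 : ℕ) : Cardinal) ≤ Algebra.trdeg ℚ
      ↥(IntermediateField.adjoin ℚ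
        (Set.range ![↑Real.pi * Complex.I, ↑Real.pi / 2 + Complex.I] ∪
          Set.range (Complex.exp ∘ ![↑Real.pi * Complex.I, ↑Real.pi / 2 + Complex.I]))) := by
  refine stub_cruxCell_piI_of_re (1 / 2) _ (by norm_num) rfl (Or.inl ?_)
  simp only [Matrix.cons_val_one, Matrix.cons_val_fin_one, Complex.add_re, Complex.I_re, add_zero]
  rw [Complex.div_re]
  simp
  ring

end Summit.Schanuel.Schanuel.Theorems.RigidCore

end
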